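import Literature.Dynamics.TransferOperators.ChangMayerEigenfunction
import Summits.RiemannHypothesis.RiemannHypothesis.Theses.MayerPairing
import Summits.RiemannHypothesis.RiemannHypothesis.Theorems.MayerPairingEigenvaluePredicate
import Summits.RiemannHypothesis.RiemannHypothesis.Theorems.MayerPairingTargetWeakenings

/-!
# Sketch (crux-ideate r1, ideator 2, gen 2) — `UnitCircleCrossedOnce` (stmt-RiemannHypothesis-1470)

Scratch file: first-lemma signatures over EXISTING declarations, for the crux NOTES workfile.
The crux itself is numerically refuted (K1; `MayerBulgeWitness → ¬ UnitCircleCrossedOnce` in tree);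
the statements below concern (i) the exact-left repair W1 in operator language, (ii) two exact
Eisenstein identities every future line on this operator can use, (iii) the finite-dimensional
model of the exceptional-point obstruction (barrier lemma).  Nothing here is filed as an item.
-/

noncomputable section

open Complex Filter Topology
open Literature.Dynamics.TransferOperators
open Summit.RiemannHypothesis.RiemannHypothesis.Theses.MayerPairing

namespace Summit.RiemannHypothesis.RiemannHypothesis.Cruxes.UnitCircleCrossedOnce.Ideator2

/-- **W1 in operator language** (candidate repaired crux `UnitCircleCrossedOnceR`, exact-left form):
no continuous selection of nonzero eigenvalues of `L_{σ+iτ}` (`|τ| ≥ 7`) on `[a,b] ⊂ (0,1/2)` starts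
at the EXACT eigenvalue `1` and has modulus `1` at the right end.  ζ-free as typed; its content sits
at zero heights (converse dictionary), where it says the Eisenstein branch never returns to the unit
circle right of `Re ρ/2`. -/
def ExactLeftOp : Prop :=
  ∀ τ : ℝ, 7 ≤ |τ| → ∀ a b : ℝ, 0 < a → a < b → b < 1 / 2 → ∀ Λ : ℝ → ℂ,
    ContinuousOn Λ (Set.Icc a b) →
    (∀ σ ∈ Set.Icc a b, Λ σ ≠ 0 ∧ ∃ g : MayerSpace, g ≠ 0 ∧
      mayerTransfer ((σ : ℂ) + (τ : ℂ) * I) g = Λ σ • g) →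
    ¬ (Λ a = 1 ∧ ‖Λ b‖ = 1)

/-- The inlined (route-vocabulary) form of W1 = hypothesis of
`mayerPairing_riemannHypothesis_of_exactLeft` (in tree). -/
def ExactLeftInlined : Prop :=
  ∀ τ : ℝ, 7 ≤ |τ| → ∀ a b : ℝ, 0 < a → a < b → b < 1 / 2 → ∀ Λ : ℝ → ℂ,
    ContinuousOn Λ (Set.Icc a b) →
    (∀ σ ∈ Set.Icc a b, ∃ f : ℂ → ℂ, ∃ δ : ℝ, 0 < δ ∧ DifferentiableOn ℂ f {z : ℂ | -δ < z.re} ∧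
      (∃ z : ℂ, 0 < z.re ∧ f z ≠ 0) ∧
      (∀ z : ℂ, -δ < z.re → Λ σ * (f z - f (z + 1)) =
        (z + 1) ^ (-(2 * ((σ : ℂ) + (τ : ℂ) * Complex.I))) * f (1 / (z + 1))) ∧
      Tendsto (fun x : ℝ => Λ σ * f x -
        f 0 * ((x : ℂ) + 1) ^ (1 - 2 * ((σ : ℂ) + (τ : ℂ) * Complex.I)) /
        (2 * ((σ : ℂ) + (τ : ℂ) * Complex.I) - 1)) atTop (𝓝 0)) →
    ¬ (Λ a = 1 ∧ ‖Λ b‖ = 1)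

/-- First lemma of the repair line: the two forms of W1 agree (predicate audit
`mayerPairing_isEigen_iff`, pointwise in `σ`). -/
theorem exactLeftOp_iff_inlined : ExactLeftOp ↔ ExactLeftInlined := by
  constructor
  · intro h τ hτ a b ha hab hb Λ hΛ heig
    refine h τ hτ a b ha hab hb Λ hΛ fun σ hσ => ?_
    obtain ⟨hs, hs'⟩ :=
      Summit.RiemannHypothesis.RiemannHypothesis.Theorems.mayerPairing_param_ok
        (σ := σ) (τ := τ) (ha.trans_le hσ.1) (hσ.2.trans_lt hb)
    exact (Summit.RiemannHypothesis.RiemannHypothesis.Theorems.mayerPairing_isEigen_iff hs hs').1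
      (heig σ hσ)
  · intro h τ hτ a b ha hab hb Λ hΛ heig
    refine h τ hτ a b ha hab hb Λ hΛ fun σ hσ => ?_
    obtain ⟨hs, hs'⟩ :=
      Summit.RiemannHypothesis.RiemannHypothesis.Theorems.mayerPairing_param_ok
        (σ := σ) (τ := τ) (ha.trans_le hσ.1) (hσ.2.trans_lt hb)
    exact (Summit.RiemannHypothesis.RiemannHypothesis.Theorems.mayerPairing_isEigen_iff hs hs').2
      (heig σ hσ)

/-- W1 (operator form) closes the route with `BranchPairing` (via the in-tree
`mayerPairing_riemannHypothesis_of_exactLeft`). -/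
theorem riemannHypothesis_of_exactLeftOp (hW : ExactLeftOp) (hB : BranchPairing) :
    _root_.Summit.RiemannHypothesis :=
  Summit.RiemannHypothesis.RiemannHypothesis.Theorems.mayerPairing_riemannHypothesis_of_exactLeft
    (exactLeftOp_iff_inlined.1 hW) hB

/-- **The ζ-free surplus of W1 (what RH does NOT give back): "Eisenstein no-return".**  At any
height, a continuous selection of nonzero eigenvalues of `L_{σ+iτ}` on `[1/4, b]`, `b < 1/2`, that
starts at the exact eigenvalue `1` at `σ = 1/4` does not have modulus `1` at `b`.  (Numerically: the
branch through `1` at `ρ_k/2` has strictly σ-decreasing modulus on `[0, 1/2]` for `k ≤ 30`,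
prover seat MayerPairing-2; its cheapest falsifier is an exceptional point of that branch right of
`1/4` within `~0.03` of a zero height.) -/
def EisensteinNoReturn : Prop :=
  ∀ τ : ℝ, 7 ≤ |τ| → ∀ b : ℝ, 1 / 4 < b → b < 1 / 2 → ∀ Λ : ℝ → ℂ,
    ContinuousOn Λ (Set.Icc (1 / 4) b) →
    (∀ σ ∈ Set.Icc (1 / 4 : ℝ) b, Λ σ ≠ 0 ∧ ∃ g : MayerSpace, g ≠ 0 ∧
      mayerTransfer ((σ : ℂ) + (τ : ℂ) * I) g = Λ σ • g) →
    Λ (1 / 4) = 1 → ‖Λ b‖ ≠ 1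

/-- `ExactLeftOp` contains `EisensteinNoReturn` (the case `a = 1/4`). -/
theorem eisensteinNoReturn_of_exactLeftOp (h : ExactLeftOp) : EisensteinNoReturn := by
  intro τ hτ b hb hb' Λ hΛ heig h1 hnorm
  exact h τ hτ (1 / 4) b (by norm_num) hb hb' Λ hΛ heig ⟨h1, hnorm⟩

/-- **Eisenstein projection identity** (exact, all `s` in the strip; the Fermi-golden-rule at `ρ/2`
is its `s`-derivative): for every LEFT eigenfunctional `ℓ ∘ L_s = μ ℓ` one has
`(μ - 1) ℓ(h_s) = -(ζ(2s)/2) ℓ(𝟙)`, where `h_s(z) = ψ(2s, z+1)` is the Chang–Mayer function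
(`mayerTransfer_zagierPsi_toFun`: `L_s h_s = h_s - ζ(2s)/2 · 𝟙`).  Consequence: a branch `k` has
`λ_k(s) = 1 - (ζ(2s)/2) ℓ_k(𝟙)/ℓ_k(h_s)`; at a zero of `ζ(2s)` it passes through `1` iff
`ℓ_k(h_s) ≠ 0`; cusp-type functionals have `ℓ(𝟙) = 0`. -/
def EisensteinProjectionIdentity : Prop :=
  ∀ s : ℂ, 0 < s.re → s.re < 1 / 2 → ∀ (ℓ : MayerSpace →L[ℂ] ℂ) (μ : ℂ),
    ℓ.comp (mayerTransfer s) = μ • ℓ →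
    ∀ H : MayerSpace, (∀ z ∈ mayerClosedDisc, H.toFun z = zagierPsi (2 * s) (z + 1)) →
    ∀ E : MayerSpace, (∀ z ∈ mayerClosedDisc, E.toFun z = 1) →
    (μ - 1) * ℓ H = -(riemannZeta (2 * s) / 2) * ℓ E

/-- **Resolvent matrix element at `μ = 1`** (exact): if `1 - L_s` is injective and
`(1 - L_s) G = 𝟙`, then `G(0) = 2 ζ(2s-1)/ζ(2s)` (`G = (2/ζ(2s)) h_s`, `h_s(0) = ψ(2s,1) = ζ(2s-1)`,
`zagierPsi_one`).  Through the Neumann series `G(0) = Σ_k (L_s^k 𝟙)(0) = Σ over continued-fraction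
strings of `q^{-2s}` this is the Euclidean-algorithm generating function `Σ_q 2φ(q) q^{-2s}`; its
`w`-deformation `Σ_strings w^k q^{-2s} = ⟨δ₀, (1 - w L_s)^{-1} 𝟙⟩` (Hensley / Baladi–Vallée) has poles in
`s` exactly where `w^{-1} ∈ spec L_s` is visible from `(δ₀, 𝟙)`: unit-modulus eigenvalues of `L_s` =
poles of the `θ`-twisted series `Σ_x e^{iθ ℓ(x)} q(x)^{-2s}`, and the `θ = 0` slice is `{ρ/2}`. -/
def ResolventAtOne : Prop :=
  ∀ s : ℂ, 0 < s.re → s.re < 1 / 2 → riemannZeta (2 * s) ≠ 0 →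
    (∀ f : MayerSpace, mayerTransfer s f = f → f = 0) →
    ∀ G E : MayerSpace, (∀ z ∈ mayerClosedDisc, E.toFun z = 1) →
    G - mayerTransfer s G = E →
    G.toFun 0 = 2 * riemannZeta (2 * s - 1) / riemannZeta (2 * s)

/-- **Barrier lemma, finite-dimensional model of the exceptional-point obstruction.**  The generic
unfolding `Λ± = λ₀ ± √(c (s - s₀))` of a `2 × 2` Jordan block with `|λ₀| = 1`, `c ≠ 0`, has, on
horizontal lines arbitrarily close to `Im s₀`, a continuous eigenvalue selection whose modulus is
`1` at two distinct abscissae near `Re s₀` and `≠ 1` in between (a dip/bulge).  Any holomorphic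
compact family with a unit-modulus (or near-unit, by continuity) exceptional point in the open
strip therefore violates "unit circle crossed once" — the mechanism of both K1 witnesses. -/
def JordanUnfoldingDoubleCrossing : Prop :=
  ∀ lam0 c s0 : ℂ, ‖lam0‖ = 1 → c ≠ 0 → ∀ ε : ℝ, 0 < ε → ∃ τ : ℝ, |τ - s0.im| < ε ∧ τ ≠ s0.im ∧
    ∃ a b : ℝ, a < b ∧ |a - s0.re| < ε ∧ |b - s0.re| < ε ∧
    ∃ Λ : ℝ → ℂ, ContinuousOn Λ (Set.Icc a b) ∧
      (∀ σ ∈ Set.Icc a b, (Λ σ - lam0) ^ 2 = c * (((σ : ℂ) + (τ : ℂ) * I) - s0)) ∧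
      ‖Λ a‖ = 1 ∧ ‖Λ b‖ = 1 ∧ ∃ m ∈ Set.Ioo a b, ‖Λ m‖ ≠ 1

end Summit.RiemannHypothesis.RiemannHypothesis.Cruxes.UnitCircleCrossedOnce.Ideator2
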